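import Summits.AtomisticToContinuum.Crystallization.Theorems.FrustratedLawDichotomyStrainedPatchHomValueT2SlopeSoundA

/-!
# (I1) slope part I — the CHARGES of the slope report in `SC` units (`…HomValueT2Track` §14b: `f`, `j`, `h` entries of `t2SlopeT2`), and the symmetry of
# `ddF` (for the triangular `rp` fold); critic row 1674 (B) (I1) docket item 3 `slopeT2_sound`, ninth instalment; 27623 `(H) HomFloor`; decomp-a2c hand-1 g49

* `fc_charge_le`: `|F^c_a|·SC ≤ |fc_a|↑` for a member;  `jc_charge_le`: `|Σ_{e<6} J_e δ_e| ≤ (Σ_e |I_e|↑ wf_e)/SC²` for members `J_e ∈ I_e`, `|δ_e| ≤ wf_e/SC`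
  (the kit's `j` numerator as a `List.range 6` fold);  `hp_charge_le`: `Σ_{e<6} |jF|↑/SC |δ_e| ≤ (Σ_e |jF|↑ wf_e)/SC²` (the kit's `hp` numerator);
* `ddF_symm`: `ddF R a k l = ddF R a l k` (`k, l < 9`).
FINDING (for the assembly, recorded here): the kit's `rp` entry applies an inner FLOOR division `(|ddF|↑·wf_k) / SC` before multiplying by `wf_l`, so
`r_a = ⌈rp_a/(2SC)⌉` under-counts the exact second-order numerator by at most `Σ_{k≤l} wt_kl·wf_l ≤ 81·SC` per Lipschitz label, i.e. `≤ 41` ulps per label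
after the division: the sound statement is `|F_a|·SC ≤ G_a + 41·#LB` (or the kernel should use `cdiv` inside) — see the hand-1 g49 notes.
No definitions; 0 sorry; standard axioms.  `--supports stmt-AtomisticToContinuum-27623`.
-/

noncomputable section

namespace Summit.AtomisticToContinuum.Crystallization.Theorems.FrustratedLawDichotomyStrainedPatchHomValueT2Kit

open scoped BigOperators
open Finset
open Literature.Analysis.ValidatedNumerics.Numerics

/-! ## §1. Charges -/

/-- `|x|·SC ≤ |I|↑` for a member (the point-force entry `f_a = |fc_a|↑`). [arithmetic] -/
theorem fc_charge_le {x : ℝ} {I : FI} (h : FI.mem x I) : |x| * SC ≤ ((I.absHi : ℤ) : ℝ) := FI.abs_le_absHi h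

/-- ★ The cancelling first-order charge: members `J_e ∈ I_e` and `|δ_e| ≤ wf_e/SC` (`e < 6`) ⟹ `|Σ_e J_e δ_e| ≤ (Σ_e |I_e|↑ wf_e)/SC²`, the numerator being
the kit's `List.range 6` fold. [arithmetic] -/
theorem jc_charge_le (J : ℕ → ℝ) (I : ℕ → FI) (hJ : ∀ e, e < 6 → FI.mem (J e) (I e)) (wf : Array ℤ) (δ : ℕ → ℝ)
    (hδ : ∀ e, e < 6 → |δ e| ≤ ((wf.getD e 0 : ℤ) : ℝ) / SC) :
    |∑ e ∈ range 6, J e * δ e| ≤ (((List.range 6).foldl (fun s e => s + (I e).absHi * wf.getD e 0) 0 : ℤ) : ℝ) / ((SC : ℝ) * SC) := by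
  have hS := SC_pos
  rw [foldl_add_range, zero_add]
  push_cast
  rw [Finset.sum_div]
  refine (Finset.abs_sum_le_sum_abs _ _).trans (Finset.sum_le_sum fun e he => ?_)
  have he6 := Finset.mem_range.1 he
  have h1 : |J e| ≤ (((I e).absHi : ℤ) : ℝ) / SC := by rw [le_div_iff₀ hS]; exact FI.abs_le_absHi (hJ e he6)
  have h0 : (0 : ℝ) ≤ (((I e).absHi : ℤ) : ℝ) / SC := div_nonneg (by exact_mod_cast absHi_nonneg _) hS.le
  rw [abs_mul]
  calc |J e| * |δ e| ≤ (((I e).absHi : ℤ) : ℝ) / SC * (((wf.getD e 0 : ℤ) : ℝ) / SC) :=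
        mul_le_mul h1 (hδ e he6) (abs_nonneg _) h0
    _ = (((I e).absHi : ℤ) : ℝ) * ((wf.getD e 0 : ℤ) : ℝ) / ((SC : ℝ) * SC) := by ring

/-- ★ The junction-class first-order charge: `Σ_{e<6} |jF aP Rb a e|↑/SC · |δ_e| ≤ (Σ_e |jF|↑ wf_e)/SC²`, the numerator being the kit's `hp` fold. [arithmetic] -/
theorem hp_charge_le (aP : Fin 3 → Fin 6 → ℤ) (Rb : DRec) (a : Fin 3) (wf : Array ℤ) (δ : ℕ → ℝ)
    (hδ : ∀ e, e < 6 → |δ e| ≤ ((wf.getD e 0 : ℤ) : ℝ) / SC) :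
    ∑ e ∈ range 6, (((jF aP Rb a e).absHi : ℤ) : ℝ) / SC * |δ e| ≤
      (((List.range 6).foldl (fun s e => s + (jF aP Rb a e).absHi * wf.getD e 0) 0 : ℤ) : ℝ) / ((SC : ℝ) * SC) := by
  have hS := SC_pos
  rw [foldl_add_range, zero_add]
  push_cast
  rw [Finset.sum_div]
  refine Finset.sum_le_sum fun e he => ?_
  have he6 := Finset.mem_range.1 he
  have h0 : (0 : ℝ) ≤ (((jF aP Rb a e).absHi : ℤ) : ℝ) / SC := div_nonneg (by exact_mod_cast absHi_nonneg _) hS.le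
  calc (((jF aP Rb a e).absHi : ℤ) : ℝ) / SC * |δ e| ≤ (((jF aP Rb a e).absHi : ℤ) : ℝ) / SC * (((wf.getD e 0 : ℤ) : ℝ) / SC) :=
        mul_le_mul_of_nonneg_left (hδ e he6) h0
    _ = (((jF aP Rb a e).absHi : ℤ) : ℝ) * ((wf.getD e 0 : ℤ) : ℝ) / ((SC : ℝ) * SC) := by ring

/-! ## §2. `ddF` is symmetric -/

/-- The kit's mixed second derivatives are symmetric. [formal bookkeeping] -/
theorem d2_symm {k l : ℕ} (hk : k < 9) (hl : l < 9) (cc : Fin 3) : d2 k l cc = d2 l k cc := by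
  have h : ((d2 k l cc : ℤ) : ℝ) = ((d2 l k cc : ℤ) : ℝ) := by rw [d2_cast hk hl, d2_cast hl hk, ddyR_symm]
  exact_mod_cast h

/-- The symmetric index is symmetric. [formal bookkeeping] -/
theorem sIx_symm (k l : ℕ) : sIx k l = sIx l k := by
  unfold sIx
  by_cases h1 : k ≤ l
  · by_cases h2 : l ≤ k
    · have : k = l := le_antisymm h1 h2
      subst this; rfl
    · rw [if_pos h1, if_neg h2]
  · rw [if_neg h1, if_pos (not_le.1 h1).le]

/-- Interval addition is commutative. [arithmetic] -/
theorem FI_add_comm (I J : FI) : I.add J = J.add I := by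
  cases I; cases J; simp [FI.add, add_comm]

/-- ★ `ddF R a k l = ddF R a l k` (`k, l < 9`). [formal bookkeeping] -/
theorem ddF_symm (R : DRec) (a : Fin 3) {k l : ℕ} (hk : k < 9) (hl : l < 9) : ddF R a k l = ddF R a l k := by
  unfold ddF
  rw [sIx_symm k l, d2_symm hk hl, FI_add_comm ((R.z k).mul (R.d l a.val)) ((R.z l).mul (R.d k a.val))]

end Summit.AtomisticToContinuum.Crystallization.Theorems.FrustratedLawDichotomyStrainedPatchHomValueT2Kit
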